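import Summits.ABC.StewartYu.PadicG3TwoMainChain
import Summits.ABC.StewartYu.PadicTwoSatData
import HarnessLib

/-!
# Cell abc-stewartyu, WP-L.P(2) (crux r4 `PadicCoreTwoRat`, stmt-ABC-20504), layer K2b: the INNER CHAIN of the
# level induction on the 𝔑-THREADED family — `KFinalTwoSat σ F Bv I ⇒ KChainTwo σ (ShSat F Bv Sh) I`

`Summits/ABC/StewartYu/PadicG3TwoMainChainSat.lean` — cell `abc-stewartyu` (HOME `run/shared/lean/pub/abc-stewartyu/`),
route `YuMatveevShapeRat`, seat p3 (g9, WP-L.P(2) lead; design memo HOME/p3/memo-11 §2 rows «k-step chains» / «levels»).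
One shape predicate, one real-valued definition, one `Prop`-structure and theorems on `TwoSetup`; no named fact.

DESIGN (memo-11 §2, confirmed g9): the landed level induction `PadicG3TwoMain` (`G3Fam`, `G3TwoSched`, `G3Adm`,
`SiegelTwo`/`KChainTwo`/`ThirdStepTwo`/`InvTwo`, `mainTwo`) is consumed VERBATIM by the 𝔑-threaded frame: the
schedule's coordinate box `Dbox I`/`Dθ I` stays a (true, coarse) bound used only for the directional scalars, and the
VIRTUAL box of level `I` — `|(κᵢ ᵥ* F.U)ⱼ| ≤ Bv I j` for every unknown, `κᵢ = (uᵢ, u_θᵢ)` — rides in the assembler's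
opaque shape slot `Sh` as **`ShSat F Bv Sh I Λ`**.  The landed inner chain `PadicG3TwoMainChain.kchainTwo_of_kfinal`
clears monomials with `monDen all (boxExp (Dbox I) (Dθ I) x)` (unaffordable on the skew family, memo-11 §0); this file
re-proves it with the virtual clearing denominator `F.Dm (Bv I) x` of `PadicTwoSatData`:

* `ShSat F Bv Sh` — the shape predicate carrying the virtual box (and the assembler's own `Sh`);
* `KTwoSat σ F Bv I x τ = cardB I · P · (M₀ I x τ · Xb I^{|t|} · Dm(Bv I, x)²)` — the Liouville constant;
* `KFinalTwoSat σ F Bv I` — the record's obligations for the inner chain of level `I` (= `KFinalTwo` with `KTwoSat`);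
* **`kchainTwo_of_kfinalSat`** — `KFinalTwoSat σ F Bv I → KChainTwo σ (ShSat F Bv Sh) I` (sub-step `0` from the nodes
  coprime to `3` by `SatData.kstep_cop_sat`, sub-steps `k ≥ 1` from all nodes by `SatData.kstep_Icc_sat`);
* `mainTwo_of_kfinalSat` — the landed `mainTwo` with the inner chains discharged on the 𝔑-threaded family.

WHAT THIS IS NOT: no schedule (record seat), no START, no third step, no END; no crux moves (A1.L not moved).

References: K. Yu, Acta Math. 211 (2013), Lemma 5.2 (5.23)–(5.31); Yu. V. Nesterenko, LNM 1819 (2003), §4.1–4.3;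
HOME/p3/memo-11 §2.
-/

noncomputable section

open Finset Polynomial
open scoped Matrix
open Literature.NumberTheory.Transcendental
open Literature.NumberTheory.Transcendental.CW77.Setup (Tau tauNorm)
open Literature.NumberTheory.Transcendental.PadicCW77 (condExp)

namespace Summit.ABC.StewartYu

namespace TwoSetup

variable {S : TwoSetup} {ι : Type*} (σ : S.G3TwoSched) (F : S.SatData) (Bv : ℕ → Fin (S.d + 1) → ℕ)
  (Sh : ℕ → S.G3Fam ι → Prop)

/-! ### The shape predicate carrying the virtual box -/

/-- **The shape predicate of the 𝔑-threaded frame**: at level `I` every unknown's exponent vector `κᵢ = (uᵢ, u_θᵢ)`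
has virtual exponents in the box `Bv I` (`|(κᵢ ᵥ* U)ⱼ| ≤ Bv I j`), and the assembler's own invariant `Sh I Λ` holds.
[cite: Nesterenko2003, §4.3 (the lattices 𝔏ₛ); shape only] -/
def ShSat (I : ℕ) (Λ : S.G3Fam ι) : Prop :=
  (∀ i ∈ Λ.B, ∀ j, |(S.allκ Λ.u Λ.uθ i ᵥ* F.U) j| ≤ (Bv I j : ℤ)) ∧ Sh I Λ

/-- The virtual box of an admissible family of the 𝔑-threaded frame. [folklore] -/
theorem vbox_of_adm {I : ℕ} {Λ : S.G3Fam ι} (hadm : S.G3Adm σ (ShSat F Bv Sh) I Λ) :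
    ∀ i ∈ Λ.B, ∀ j, |(S.allκ Λ.u Λ.uθ i ᵥ* F.U) j| ≤ (Bv I j : ℤ) :=
  hadm.shape.1

/-! ### The record's obligations for the inner chain of level `I` -/

/-- **The Liouville constant of level `I` on the 𝔑-threaded family** at the point `x` and the multi-index `τ`:
`cardB I · P · (M₀ I x τ · Xb I^{∑ tⱼ} · Dm(Bv I, x)²)`. [cite: Yu2013, (5.35)–(5.40); shape only] -/
def KTwoSat (I : ℕ) (x : ℤ) (τ : Tau S.d) : ℝ :=
  (σ.cardB I : ℝ) * σ.P * (σ.M₀ I x τ * (σ.Xb I : ℝ) ^ (∑ j, τ.2 j) * ((F.Dm (Bv I) x : ℝ)) ^ 2)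

/-- **THE RECORD'S OBLIGATIONS FOR THE INNER CHAIN OF LEVEL `I` ON THE 𝔑-THREADED FAMILY**: `KFinalTwo` with the
Liouville constant `KTwoSat`. [cite: Yu2013, Lemma 5.2 (5.28)–(5.31), (5.40)–(5.41); shape only] -/
structure KFinalTwoSat (I : ℕ) : Prop where
  /-- the chain starts at the level's initial range -/
  Nsub_zero : σ.Nsub I 0 = σ.N0 I
  /-- the chain reaches the level's final range -/
  Nfin_le : σ.Nfin I ≤ σ.Nsub I (σ.kst I)
  /-- the chain's order budget -/
  Tfin_le : σ.Tfin I + σ.kst I * σ.tdec I ≤ σ.T0 I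
  /-- at least one sub-step (the coprime one) -/
  one_le_kst : 1 ≤ σ.kst I
  /-- positive order decrement -/
  one_le_tdec : 1 ≤ σ.tdec I
  /-- the directional bound is a nonnegative number -/
  Xb_nonneg : 0 ≤ σ.Xb I
  /-- the `Y₀`-weight denominators are positive -/
  one_le_den₀ : ∀ (x : ℤ) (τ : Tau S.d), 1 ≤ σ.den₀ I x τ
  /-- the Liouville constant is positive -/
  KTwoSat_pos : ∀ (x : ℤ) (τ : Tau S.d), 0 < KTwoSat σ F Bv I x τ
  /-- the numeric inequality of every sub-step -/
  hfinal : ∀ k, k < σ.kst I → ∀ x₁ : ℤ, |x₁| ≤ (σ.Nsub I (k + 1) : ℤ) → ∀ τ : Tau S.d,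
    tauNorm τ + σ.tdec I ≤ σ.T0 I - k * σ.tdec I →
    max (σ.Bw I * ‖S.Λ₀‖ * (2 : ℝ) ^ σ.tdec I * (2 : ℝ) ^ condExp 2 (2 * σ.Nsub I k + 1) (σ.tdec I))
        (σ.Bw I / (4 * (2 : ℝ) ^ σ.m) ^ gainExp σ I k) < 1 / KTwoSat σ F Bv I x₁ τ

/-! ### The inner chain, proved -/

/-- The hypotheses of the k-step from admissibility: sign facts and the Liouville-constant comparison (virtual
denominator). [folklore] -/
theorem kstep_data_of_admSat {I : ℕ} {Λ : S.G3Fam ι} (hadm : S.G3Adm σ (ShSat F Bv Sh) I Λ) (hXb : 0 ≤ σ.Xb I) :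
    0 ≤ σ.Bw I ∧ 0 ≤ σ.P ∧ (∀ (x : ℤ) (τ : Tau S.d), 0 ≤ σ.M₀ I x τ) ∧
    ∀ (x : ℤ) (τ : Tau S.d), (Λ.B.card : ℝ) * σ.P * (σ.M₀ I x τ * (σ.Xb I : ℝ) ^ (∑ j, τ.2 j) *
      ((F.Dm (Bv I) x : ℝ)) ^ 2) ≤ KTwoSat σ F Bv I x τ := by
  obtain ⟨i, hi, _⟩ := hadm.exists_ne
  have hBw0 : 0 ≤ σ.Bw I := by
    have h := hadm.wt i hi 0 0
    rw [pow_zero, mul_one] at h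
    exact (norm_nonneg _).trans h
  have hP0 : 0 ≤ σ.P := (abs_nonneg _).trans (hadm.p_le i hi)
  have hM0 : ∀ (x : ℤ) (τ : Tau S.d), 0 ≤ σ.M₀ I x τ := by
    intro x τ
    obtain ⟨z₀, _, hz₀⟩ := hadm.hasse i hi x τ
    exact (abs_nonneg _).trans hz₀
  refine ⟨hBw0, hP0, hM0, fun x τ => ?_⟩
  unfold KTwoSat
  have hcard : (Λ.B.card : ℝ) ≤ σ.cardB I := by exact_mod_cast hadm.card_le
  have hbr : (0 : ℝ) ≤ σ.M₀ I x τ * (σ.Xb I : ℝ) ^ (∑ j, τ.2 j) * ((F.Dm (Bv I) x : ℝ)) ^ 2 := by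
    have h1 : (0 : ℝ) ≤ σ.M₀ I x τ := by exact_mod_cast hM0 x τ
    have h2 : (0 : ℝ) ≤ (σ.Xb I : ℝ) ^ (∑ j, τ.2 j) := pow_nonneg (by exact_mod_cast hXb) _
    positivity
  have hP0' : (0 : ℝ) ≤ σ.P := by exact_mod_cast hP0
  exact mul_le_mul_of_nonneg_right (mul_le_mul_of_nonneg_right hcard hP0') hbr

/-- **THE INNER CHAIN OF LEVEL `I` ON THE 𝔑-THREADED FAMILY FROM THE RECORD'S NUMERICS**:
`KFinalTwoSat σ F Bv I → KChainTwo σ (ShSat F Bv Sh) I`.  Sub-step `0` runs from the nodes coprime to `3`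
(`SatData.kstep_cop_sat`), sub-steps `k ≥ 1` from all nodes (`SatData.kstep_Icc_sat`); the monomials are cleared by
the virtual denominator read off the shape slot. [cite: Yu2013, Lemma 5.2] [cite: Nesterenko2003, §4.1–4.3] -/
theorem kchainTwo_of_kfinalSat {I : ℕ} (hfin : KFinalTwoSat σ F Bv I) : KChainTwo σ (ShSat F Bv Sh) I := by
  intro Λ hadm hvan
  obtain ⟨hBw0, hP0, hM0, hK⟩ := kstep_data_of_admSat σ F Bv Sh hadm hfin.Xb_nonneg
  have hvbox := vbox_of_adm σ F Bv Sh hadm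
  have ht : 1 ≤ σ.tdec I := hfin.one_le_tdec
  have hR : ∀ (x : ℤ) (τ : Tau S.d), ∀ i ∈ Λ.B, ∃ z₀ : ℤ,
      (σ.den₀ I x τ : ℚ) * (hasseDeriv τ.1 (Λ.R i)).eval (x : ℚ) = z₀ ∧ |z₀| ≤ σ.M₀ I x τ :=
    fun x τ i hi => hadm.hasse i hi x τ
  -- the claim after `k ≥ 1` sub-steps
  have hchain : ∀ k, 1 ≤ k → k ≤ σ.kst I →
      Λ.vanish nodesAll (σ.Nsub I k) (σ.T0 I - k * σ.tdec I) := by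
    intro k
    induction k with
    | zero => intro h; omega
    | succ k ih =>
      intro _ hk
      rcases Nat.eq_zero_or_pos k with hk0 | hkpos
      · -- sub-step `0`: from the coprime nodes
        subst hk0
        have hzero : ∀ x : ℤ, |x| ≤ (σ.Nsub I 0 : ℤ) → ¬ (3 : ℤ) ∣ x → ∀ τ'' : Tau S.d,
            tauNorm τ'' < σ.T0 I → S.g3φ Λ.R Λ.u Λ.uθ Λ.B Λ.p τ'' x = 0 := by
          intro x hx h3 τ'' hτ''
          rw [hfin.Nsub_zero] at hx
          exact hvan x hx h3 τ'' hτ''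
        have hfinal0 := hfin.hfinal 0 (by omega)
        simp only [gainExp, Nat.zero_mul, Nat.sub_zero, zero_add] at hfinal0
        have key := F.kstep_cop_sat Λ.R Λ.u Λ.uθ Λ.B Λ.p Λ.i₀ hadm.slab (N := σ.Nsub I 0)
          (N' := σ.Nsub I 1) (Tlo := σ.T0 I) ht hBw0 hadm.wt hzero hvbox (σ.den₀ I)
          hfin.one_le_den₀ (σ.M₀ I) hR hadm.dir_le hadm.p_le (KTwoSat σ F Bv I) hfin.KTwoSat_pos hK hfinal0
        intro x hx _ τ hτ
        exact key x hx τ (by omega)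
      · -- sub-step `k ≥ 1`: from all the nodes
        have hprev := ih hkpos (by omega)
        have hzero : ∀ x : ℤ, |x| ≤ (σ.Nsub I k : ℤ) → ∀ τ'' : Tau S.d,
            tauNorm τ'' < σ.T0 I - k * σ.tdec I → S.g3φ Λ.R Λ.u Λ.uθ Λ.B Λ.p τ'' x = 0 :=
          fun x hx τ'' hτ'' => hprev x hx trivial τ'' hτ''
        have hfinalk := hfin.hfinal k (by omega)
        have hk0' : k ≠ 0 := by omega
        simp only [gainExp, hk0', if_false] at hfinalk
        have key := F.kstep_Icc_sat Λ.R Λ.u Λ.uθ Λ.B Λ.p Λ.i₀ hadm.slab (N := σ.Nsub I k)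
          (N' := σ.Nsub I (k + 1)) (Tlo := σ.T0 I - k * σ.tdec I) ht hBw0 hadm.wt hzero hvbox
          (σ.den₀ I) hfin.one_le_den₀ (σ.M₀ I) hR hadm.dir_le hadm.p_le (KTwoSat σ F Bv I)
          hfin.KTwoSat_pos hK hfinalk
        intro x hx _ τ hτ
        refine key x hx τ ?_
        rw [Nat.succ_mul] at hτ
        omega
  have hlast := hchain (σ.kst I) hfin.one_le_kst le_rfl
  refine Λ.vanish_mono hfin.Nfin_le ?_ hlast
  have := hfin.Tfin_le
  omega

/-- **`mainTwo` on the 𝔑-threaded family with the inner chains discharged from the record's numerics**: Siegel +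
`KFinalTwoSat` at every level `I ≤ Istar` + the third steps ⇒ the last-level admissible family with its vanishing.
[cite: Yu2013, §5 (5.19)–(5.20); shape only] -/
theorem mainTwo_of_kfinalSat (hS : SiegelTwo σ (ShSat F Bv Sh)) (hfin : ∀ I, I ≤ σ.Istar → KFinalTwoSat σ F Bv I)
    (hth : ∀ I, I < σ.Istar → ThirdStepTwo σ (ShSat F Bv Sh) I) :
    ∃ Λ : S.G3Fam ι, S.G3Adm σ (ShSat F Bv Sh) σ.Istar Λ ∧
      Λ.vanish nodesAll (σ.Nfin σ.Istar) (σ.Tfin σ.Istar) :=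
  mainTwo σ (ShSat F Bv Sh) hS (fun I hI => kchainTwo_of_kfinalSat σ F Bv Sh (hfin I hI)) hth

end TwoSetup

end Summit.ABC.StewartYu

end
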